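import Summits.QuantumFields.YangMills.Theorems.BalabanUVNodesN15KingModelFreeEnergyDensityLimit
import HarnessLib

/-!
# BalabanUVNodes ∕ N15 — THE KING-MODEL RUNG (PART Ε-r): THE DUAL-TORUS RIEMANN ENGINE, GENERIC — `|Ω_k|⁻¹Σ_{q∈Ω̂_k} h(p′(q)) → (2π)^{−(d+1)}∫_{(−π,π]^{d+1}} h(p)dp`
# for every symbol `h` bounded on the zone and continuous at every point of the CLOSED zone `[−π,π]^{d+1}`, along any tori with all periods `→ ∞`
# (Track A, DAG node N15 = NE2; FAN-OUT v1.1 §N15 s3 «KING-MODEL RUNG»; generalises part Ε-m's engine; count-neutral)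

HONEST FRAMING.  Count-neutral (cell `pub-ymgap`, seat `pub-ymgap-dag-n15-e` g40; `--supports stmt-QuantumFields-27366 --as helper` = K3⁸).
TEMPLATE LITERATURE: C. King, Commun. Math. Phys. **102** (1986) 649–677 [King1986], (4.35) p.674 (plane-wave sums over the dual torus `p′ ∈ T_1^{(k)}`), (3.89)–(3.93)
pp.668–669 (normalisations per site); [Balaban1984PropagatorsI] (1.29) p.23 (the dual grid).  Part Ε-m proved the thermodynamic limit of `|Ω|⁻¹Σ_q log lapSym(q)` with the
g33 Riemann-sum engine `tendsto_latticeSum_of_dominated`, for the GLOBALLY continuous symbol `log(m²+cΣ(2−2cos p_μ))`.  King's block-field symbols (4.5) carry the alias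
weights `|u(p′+l)|²` whose typed real forms (`B4Strip.uFactorr`) have removable singularities filled by hand and are NOT globally continuous; what IS available is continuity
at every point of the closed zone.  THIS FILE isolates the engine at that generality: defs `bzRiemannTerm K h` (the box-supported summand `h(2πk∕K)·[−K_ν < 2k_ν ≤ K_ν]`) and
`bzMean h d` (`(2π)^{−(d+1)}∫ 1_{(−π,π]^{d+1}}·h`); `sOf_eq_cornerPt_vmaIdx` (`p′(q) = 2π·valMinAbs(q)∕K`), `bzRiemannTerm_vmaIdx`, `bzRiemannTerm_eq_zero`, ★
`sum_symbol_sOf_eq_latticeSum` (`Σ_{q∈Ω̂} h(p′(q)) = Σ_{k∈ℤ^{d+1}} bzRiemannTerm K h k`), `abs_bzMean_le`, and ★★★ **`tendsto_sum_symbol_sOf_div_card`**: for `|h| ≤ B` on the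
half-open zone and `ContinuousAt h p` at every `p` of the closed zone, `|Ω_k|⁻¹Σ_{q∈Ω̂_k} h(p′(q)) → bzMean h d` along any `M_k` with all `M_{k,ν} → ∞`.  Part Ε-m's
`tendsto_sum_log_lapSym_div_card` is the instance `h = kingLogSym c m²` (not restated); part Ε-s feeds the engine with `h = log Δ^{(K)}(·)`.

PRIOR TREE ART (used, not restated): part Ε-m (`vmaIdx`, `vmaIdx_injective`, `mem_range_vmaIdx_iff`, `eventually_inBox_iff`, `inv_card_tor_eq`), g33 `…LatticeRiemannSums`
(`cornerPt`, `floorIdx`, `tendsto_latticeSum_of_dominated`, `tendsto_cornerPt`), `B5Prop11Plancherel` (`Tor`, `sOf`).  NOT Bałaban's covariant objects; NOT a node discharge (N15 is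
booked through n15-a's knit, untouched); nothing continuum-YM ∕ `ℝ⁴` ∕ OS ∕ Clay.  0 `sorry`; two definitions (`bzRiemannTerm`, `bzMean`).

HONEST SCOPE.  Elementary analysis (dominated convergence for box-step functions); dimension written `d+1`.  Locators: [King1986] (4.35) p.674, (3.89)–(3.93) pp.668–669;
[Balaban1984PropagatorsI] (1.29) p.23.
-/

noncomputable section

open scoped BigOperators Topology
open Finset Filter MeasureTheory

namespace Summit.QuantumFields.YangMills.BalabanUVNodes.N15KingModelRung.TorusSpectral

open Literature.MathematicalPhysics.QuantumFieldTheory.Balaban1983to89.B5Prop11Plancherel (Tor sOf)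
open Summit.QuantumFields.YangMills.BalabanUVNodes.N15KingModelRung.LatticeRiemann (cornerPt floorIdx tendsto_latticeSum_of_dominated tendsto_cornerPt)

variable {d : ℕ}

/-! ## §1 The box-supported summand of a symbol -/

section Term

variable (K : Fin (d + 1) → ℕ) [hK : ∀ μ, NeZero (K μ)] (h : (Fin (d + 1) → ℝ) → ℝ)

/-- THE BOX-SUPPORTED SUMMAND of a symbol `h`: `h(2πk∕K)` if `−K_ν < 2k_ν ≤ K_ν` for all `ν` (the centred box = the range of `valMinAbs`), `0` otherwise.
[cite: Balaban1984PropagatorsI, (1.29) p.23; King1986, (4.35) p.674] -/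
def bzRiemannTerm (k : Fin (d + 1) → ℤ) : ℝ :=
  if ∀ ν, -(K ν : ℤ) < k ν * 2 ∧ k ν * 2 ≤ K ν then h (cornerPt (fun ν => 2 * Real.pi / (K ν : ℝ)) k) else 0

/-- `p′(q) = 2π·valMinAbs(q)∕K` is the mesh point of index `vmaIdx q`. [cite: King1986, (4.35) p.674] -/
theorem sOf_eq_cornerPt_vmaIdx (q : Tor K) : sOf K q = cornerPt (fun ν => 2 * Real.pi / (K ν : ℝ)) (vmaIdx K q) := by
  funext ν
  have hKν : (K ν : ℝ) ≠ 0 := by exact_mod_cast NeZero.ne (K ν)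
  simp only [cornerPt, vmaIdx, sOf]
  field_simp

/-- on the range the summand is `h(p′(q))`. [folklore] -/
theorem bzRiemannTerm_vmaIdx (q : Tor K) : bzRiemannTerm K h (vmaIdx K q) = h (sOf K q) := by
  unfold bzRiemannTerm
  rw [if_pos ((mem_range_vmaIdx_iff K _).1 ⟨q, rfl⟩), sOf_eq_cornerPt_vmaIdx]

omit hK in
/-- off the range the summand vanishes. [folklore] -/
theorem bzRiemannTerm_eq_zero [∀ μ, NeZero (K μ)] {k : Fin (d + 1) → ℤ} (hk : k ∉ Set.range (vmaIdx K)) : bzRiemannTerm K h k = 0 := by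
  rw [mem_range_vmaIdx_iff] at hk
  exact if_neg hk

/-- ★ **THE DUAL-TORUS SUM OF A SYMBOL IS A LATTICE SUM**: `Σ_{q∈Ω̂} h(p′(q)) = Σ_{k∈ℤ^{d+1}} bzRiemannTerm K h k`. [cite: King1986, (4.35) p.674; Balaban1984PropagatorsI, (1.29) p.23] -/
theorem sum_symbol_sOf_eq_latticeSum : ∑ q : Tor K, h (sOf K q) = ∑' k : Fin (d + 1) → ℤ, bzRiemannTerm K h k := by
  rw [← (vmaIdx_injective K).tsum_eq (fun k hk => ?_), tsum_fintype]
  · exact Finset.sum_congr rfl fun q _ => (bzRiemannTerm_vmaIdx K h q).symm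
  · exact Function.mem_support.mp hk |> fun h' => by_contra fun hk' => h' (bzRiemannTerm_eq_zero K h hk')

end Term

/-! ## §2 The zone mean and the limit -/

section Limit

/-- **THE ZONE MEAN** of a symbol: `(2π)^{−(d+1)}∫_{(−π,π]^{d+1}} h(p)dp` (written with the indicator of the half-open zone). [cite: King1986, (3.89)–(3.93) pp.668–669, (4.35) p.674] -/
def bzMean (h : (Fin (d + 1) → ℝ) → ℝ) (d' : ℕ) : ℝ :=
  ((2 * Real.pi) ^ (d' + 1))⁻¹ * ∫ p : Fin (d + 1) → ℝ, (if ∀ ν, -Real.pi < p ν ∧ p ν ≤ Real.pi then h p else 0)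

/-- `|bzMean h d| ≤ B` when `|h| ≤ B` on the half-open zone (`B ≥ 0`). [folklore] -/
theorem abs_bzMean_le (h : (Fin (d + 1) → ℝ) → ℝ) {B : ℝ} (hB0 : 0 ≤ B) (hB : ∀ p : Fin (d + 1) → ℝ, (∀ ν, -Real.pi < p ν ∧ p ν ≤ Real.pi) → |h p| ≤ B) :
    |bzMean h d| ≤ B := by
  have hπ := Real.pi_pos
  unfold bzMean
  have hvol : ∫ _p in Set.Icc (fun _ : Fin (d + 1) => -Real.pi) (fun _ => Real.pi), B = B * (2 * Real.pi) ^ (d + 1) := by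
    rw [setIntegral_const, measureReal_def, Real.volume_Icc_pi_toReal (by intro ν; simp only; linarith), smul_eq_mul, mul_comm]
    congr 1
    rw [Finset.prod_const, Finset.card_univ, Fintype.card_fin]
    ring
  have hle : |∫ p : Fin (d + 1) → ℝ, (if ∀ ν, -Real.pi < p ν ∧ p ν ≤ Real.pi then h p else 0)| ≤ B * (2 * Real.pi) ^ (d + 1) := by
    rw [← hvol, ← integral_indicator measurableSet_Icc]
    refine le_trans (abs_integral_le_integral_abs) (integral_mono_of_nonneg (Eventually.of_forall fun p => abs_nonneg _) ?_
      (Eventually.of_forall fun p => ?_))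
    · exact (continuousOn_const.integrableOn_compact isCompact_Icc).integrable_indicator measurableSet_Icc
    · by_cases hp : ∀ ν, -Real.pi < p ν ∧ p ν ≤ Real.pi
      · have hmem : p ∈ Set.Icc (fun _ : Fin (d + 1) => -Real.pi) (fun _ => Real.pi) := ⟨fun ν => (hp ν).1.le, fun ν => (hp ν).2⟩
        simp only [if_pos hp, Set.indicator_of_mem hmem]
        exact hB p hp
      · simp only [if_neg hp, abs_zero]
        exact Set.indicator_nonneg (fun _ _ => hB0) p
  rw [abs_mul, abs_inv, abs_of_pos (by positivity : (0 : ℝ) < (2 * Real.pi) ^ (d + 1)), inv_mul_le_iff₀ (by positivity), mul_comm]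
  exact hle

/-- ★★★ **THE DUAL-TORUS RIEMANN ENGINE**: for a symbol `h` with `|h| ≤ B` on the half-open zone and `ContinuousAt h p` at every point `p` of the closed zone `[−π,π]^{d+1}`,
along ANY sequence of tori `Π_νℤ∕M_{k,ν}` with every `M_{k,ν} → ∞` (`M_{k,ν} ≥ 1`): `|Ω_k|⁻¹Σ_{q∈Ω̂_k} h(p′(q)) → (2π)^{−(d+1)}∫_{(−π,π]^{d+1}} h(p)dp`.
[cite: King1986, (4.35) p.674, (3.89)–(3.93) pp.668–669; Balaban1984PropagatorsI, (1.29) p.23] -/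
theorem tendsto_sum_symbol_sOf_div_card (h : (Fin (d + 1) → ℝ) → ℝ) {B : ℝ} (hB0 : 0 ≤ B)
    (hB : ∀ p : Fin (d + 1) → ℝ, (∀ ν, -Real.pi < p ν ∧ p ν ≤ Real.pi) → |h p| ≤ B)
    (hcont : ∀ p : Fin (d + 1) → ℝ, (∀ ν, |p ν| ≤ Real.pi) → ContinuousAt h p)
    (Mseq : ℕ → Fin (d + 1) → ℕ) (hpos : ∀ k ν, 0 < Mseq k ν) (hlim : ∀ ν, Tendsto (fun k => (Mseq k ν : ℝ)) atTop atTop) :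
    Tendsto (fun k => haveI : ∀ ν, NeZero (Mseq k ν) := fun ν => ⟨(hpos k ν).ne'⟩
      (Fintype.card (Tor (Mseq k)) : ℝ)⁻¹ * ∑ q : Tor (Mseq k), h (sOf (Mseq k) q)) atTop (𝓝 (bzMean h d)) := by
  have hπ := Real.pi_pos
  set ℓ : ℕ → Fin (d + 1) → ℝ := fun k ν => 2 * Real.pi / (Mseq k ν : ℝ) with hℓ
  have hℓpos : ∀ k ν, 0 < ℓ k ν := fun k ν => by
    have : (0 : ℝ) < Mseq k ν := by exact_mod_cast hpos k ν
    simp only [hℓ]; positivity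
  have hℓ0 : ∀ ν, Tendsto (fun k => ℓ k ν) atTop (𝓝 0) := fun ν => by
    simp only [hℓ]; exact (tendsto_const_nhds (x := 2 * Real.pi)).div_atTop (hlim ν)
  set cs : ℕ → (Fin (d + 1) → ℤ) → ℝ := fun k => haveI : ∀ ν, NeZero (Mseq k ν) := fun ν => ⟨(hpos k ν).ne'⟩
    bzRiemannTerm (Mseq k) h with hcs
  set F : (Fin (d + 1) → ℝ) → ℝ := fun p => if ∀ ν, -Real.pi < p ν ∧ p ν ≤ Real.pi then h p else 0 with hF
  set G : (Fin (d + 1) → ℝ) → ℝ := (Set.Icc (fun _ => -Real.pi) (fun _ => 3 * Real.pi)).indicator fun _ => B with hG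
  have hGint : Integrable G := by
    rw [hG]
    have hI : IntegrableOn (fun _ : Fin (d + 1) → ℝ => B) (Set.Icc (fun _ : Fin (d + 1) => -Real.pi) (fun _ => 3 * Real.pi)) :=
      continuousOn_const.integrableOn_compact isCompact_Icc
    exact hI.integrable_indicator measurableSet_Icc
  have hcs_apply : ∀ k x, cs k (floorIdx (ℓ k) x) = if ∀ ν, -(Mseq k ν : ℤ) < ⌊x ν / (2 * Real.pi / (Mseq k ν : ℝ))⌋ * 2 ∧ ⌊x ν / (2 * Real.pi / (Mseq k ν : ℝ))⌋ * 2 ≤ Mseq k ν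
      then h (cornerPt (ℓ k) (floorIdx (ℓ k) x)) else 0 := fun k x => rfl
  -- a mesh point with index in the centred box lies in the half-open zone
  have hcorner : ∀ k x, (∀ ν, -(Mseq k ν : ℤ) < ⌊x ν / (2 * Real.pi / (Mseq k ν : ℝ))⌋ * 2 ∧ ⌊x ν / (2 * Real.pi / (Mseq k ν : ℝ))⌋ * 2 ≤ Mseq k ν) →
      ∀ ν, -Real.pi < cornerPt (ℓ k) (floorIdx (ℓ k) x) ν ∧ cornerPt (ℓ k) (floorIdx (ℓ k) x) ν ≤ Real.pi := by
    intro k x hbox ν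
    obtain ⟨h1, h2⟩ := hbox ν
    have hM : (0 : ℝ) < Mseq k ν := by exact_mod_cast hpos k ν
    have h1' : -(Mseq k ν : ℝ) < (⌊x ν / (2 * Real.pi / (Mseq k ν : ℝ))⌋ : ℝ) * 2 := by exact_mod_cast h1
    have h2' : (⌊x ν / (2 * Real.pi / (Mseq k ν : ℝ))⌋ : ℝ) * 2 ≤ Mseq k ν := by exact_mod_cast h2
    show -Real.pi < 2 * Real.pi / (Mseq k ν : ℝ) * (⌊x ν / (2 * Real.pi / (Mseq k ν : ℝ))⌋ : ℝ) ∧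
      2 * Real.pi / (Mseq k ν : ℝ) * (⌊x ν / (2 * Real.pi / (Mseq k ν : ℝ))⌋ : ℝ) ≤ Real.pi
    constructor
    · rw [div_mul_eq_mul_div, lt_div_iff₀ hM]; nlinarith
    · rw [div_mul_eq_mul_div, div_le_iff₀ hM]; nlinarith
  have hdom : ∀ k x, |cs k (floorIdx (ℓ k) x)| ≤ G x := by
    intro k x
    rw [hcs_apply]
    split_ifs with hbox
    · have hx : x ∈ Set.Icc (fun _ : Fin (d + 1) => -Real.pi) (fun _ => 3 * Real.pi) := by
        refine ⟨fun ν => ?_, fun ν => ?_⟩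
        · obtain ⟨h1, _⟩ := hbox ν
          have hM : (0 : ℝ) < Mseq k ν := by exact_mod_cast hpos k ν
          have hfl : (⌊x ν / (2 * Real.pi / (Mseq k ν : ℝ))⌋ : ℝ) ≤ x ν / (2 * Real.pi / (Mseq k ν : ℝ)) := Int.floor_le _
          have h1' : -(Mseq k ν : ℝ) < (⌊x ν / (2 * Real.pi / (Mseq k ν : ℝ))⌋ : ℝ) * 2 := by exact_mod_cast h1
          have e : x ν / (2 * Real.pi / (Mseq k ν : ℝ)) = x ν * Mseq k ν / (2 * Real.pi) := by field_simp
          rw [e] at hfl h1'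
          have : -(Mseq k ν : ℝ) < x ν * Mseq k ν / (2 * Real.pi) * 2 := by linarith
          rw [div_mul_eq_mul_div, lt_div_iff₀ (by positivity)] at this
          show -Real.pi ≤ x ν
          nlinarith
        · obtain ⟨_, h2⟩ := hbox ν
          have hM : (0 : ℝ) < Mseq k ν := by exact_mod_cast hpos k ν
          have hM1 : (1 : ℝ) ≤ Mseq k ν := by exact_mod_cast hpos k ν
          have hfl : x ν / (2 * Real.pi / (Mseq k ν : ℝ)) < (⌊x ν / (2 * Real.pi / (Mseq k ν : ℝ))⌋ : ℝ) + 1 := Int.lt_floor_add_one _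
          have h2' : (⌊x ν / (2 * Real.pi / (Mseq k ν : ℝ))⌋ : ℝ) * 2 ≤ Mseq k ν := by exact_mod_cast h2
          have e : x ν / (2 * Real.pi / (Mseq k ν : ℝ)) = x ν * Mseq k ν / (2 * Real.pi) := by field_simp
          rw [e] at hfl h2'
          have : x ν * Mseq k ν / (2 * Real.pi) * 2 < (Mseq k ν : ℝ) + 2 := by linarith
          rw [div_mul_eq_mul_div, div_lt_iff₀ (by positivity)] at this
          show x ν ≤ 3 * Real.pi
          nlinarith
      rw [hG, Set.indicator_of_mem hx]
      exact hB _ (hcorner k x hbox)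
    · rw [abs_zero, hG]
      exact Set.indicator_nonneg (fun _ _ => hB0) x
  have hlimpt : ∀ x, Tendsto (fun k => cs k (floorIdx (ℓ k) x)) atTop (𝓝 (F x)) := by
    intro x
    have hbox : ∀ᶠ k in atTop, (∀ ν, -(Mseq k ν : ℤ) < ⌊x ν / (2 * Real.pi / (Mseq k ν : ℝ))⌋ * 2 ∧ ⌊x ν / (2 * Real.pi / (Mseq k ν : ℝ))⌋ * 2 ≤ Mseq k ν)
        ↔ (∀ ν, -Real.pi < x ν ∧ x ν ≤ Real.pi) := by
      have h' := Filter.eventually_all.2 fun ν => eventually_inBox_iff (x ν) (fun k => Mseq k ν) (fun k => hpos k ν) (hlim ν)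
      filter_upwards [h'] with k hk
      exact forall_congr' hk
    by_cases hx : ∀ ν, -Real.pi < x ν ∧ x ν ≤ Real.pi
    · have hFx : F x = h x := by rw [hF]; exact if_pos hx
      rw [hFx]
      have hcontx : Tendsto (fun k => h (cornerPt (ℓ k) (floorIdx (ℓ k) x))) atTop (𝓝 (h x)) :=
        ((hcont x fun ν => abs_le.mpr ⟨(hx ν).1.le, (hx ν).2⟩).tendsto).comp (tendsto_cornerPt ℓ hℓpos hℓ0 x)
      refine hcontx.congr' ?_
      filter_upwards [hbox] with k hk
      rw [hcs_apply, if_pos (hk.2 hx)]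
    · have hFx : F x = 0 := by rw [hF]; exact if_neg hx
      rw [hFx]
      refine tendsto_const_nhds.congr' ?_
      filter_upwards [hbox] with k hk
      rw [hcs_apply, if_neg (fun h' => hx (hk.1 h'))]
  have heng := tendsto_latticeSum_of_dominated ℓ hℓpos cs F G hGint hdom hlimpt
  have hlim' := heng.const_mul (((2 * Real.pi) ^ (d + 1))⁻¹)
  refine hlim'.congr fun k => ?_
  haveI : ∀ ν, NeZero (Mseq k ν) := fun ν => ⟨(hpos k ν).ne'⟩
  rw [inv_card_tor_eq (Mseq k), sum_symbol_sOf_eq_latticeSum (Mseq k) h, mul_assoc]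
  congr 1
  rw [tsum_mul_left]

end Limit

end Summit.QuantumFields.YangMills.BalabanUVNodes.N15KingModelRung.TorusSpectral

end
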